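import Summits.NavierStokesRegularity.FluidComputer.PalasekTowerGermHostFreeRunAt

/-!
# The germ host at arbitrary rates — THE FREE-RUN DOOR AT `R` WITH ITS SCHEDULE EXPOSED: a free classical
# Navier–Stokes run from an explicit / abstract strict-slot profile meeting the first-window letter with margins gives
# a registered level-`1` STAGE OF THE EXPLICIT GERM SCHEDULE (not only `∃ S`)

Cell `ns-blowup`, seat `ns-blowup-ecbridge-3` (g12; D-0074 GROUP C «BRIDGE SUPPORT», lineage `host_preparation`).
Route `PalasekTowerBreakdown` (rev 19), crux stmt-NavierStokesRegularity-20303 `EpisodeBaseT` and the heredity pair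
20304/20305. LABEL: E–C typing + kernel analysis (theorems only; proofs ADAPTED VERBATIM from the landed
`PalasekTowerGermHostFreeRunAt` (p529… g8, `LineGermDataAt.episodeBaseGAt_of_freeRun`) and
`PalasekTowerGermHostExplicitAt` (`LineGermDataAt.episodeBaseGAt_of_sliceRun`), with the conclusion `EpisodeBaseGAt R =
∃ S, …` replaced by the STAGE of the named schedule). WHAT THIS IS NOT: not Navier–Stokes evidence — no free run
meeting the letter is exhibited; the theorems say what ONE free run would give.

## Why

`EpisodeBaseGAt R` hides the schedule behind `∃`. The refuters' decider K201 (`NoSwirlRungGAt R 1 →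
EpisodeBaseGAt R ∧ ¬ HeredityFromGAt R 1 …`) needs the SCHEDULE (to check `NoSwirlDesign`), so the germ-line doors are
re-issued here with the schedule exposed: `LineGermDataAt.nonempty_stageOne_of_sliceRun` (explicit slot, slice run
under `lineForce U σ₀ ε`) and `LineGermDataAt.exists_fade_stageOne_of_freeRun` (a FREE run with margins ⟹ for some
shorter fade `ε` and `dε : LineGermDataAt R U ρ σ₀ ε c₄`, a registered level-`1` stage of `dε.schedule hR`);
`LevelZeroDataAt.exists_lineGerm_stageOne_of_freeRun` is the abstract-slot form. Combined with
`PalasekTowerGermHostIsometry` (the germ schedule of an axisymmetric swirl-free profile is an axisymmetric swirl-free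
design) this gives, Theorems-side, `NoSwirlRungGAt R 1` from ONE sterile strict-slot free run.

References: S. Palasek, arXiv:2605.13827 §4 [cite: Palasek2026ElementaryModel, §4]; T. Tao, Anal. PDE 6 (2013)
Thm. 5.4 [cite: Tao2011, Thm. 5.4 (ii)+(iv)]; J. Leray, Acta Math. 63 (1934) §19 [cite: Leray1934, §19 (3.4)–(3.8)];
H. Sohr, *The Navier–Stokes Equations* (2001), Ch. V Thm. 1.5.1 [cite: Sohr2001, Ch. V Thm. 1.5.1].
-/

noncomputable section

namespace Summit.NavierStokesRegularity.FluidComputer.PalasekTowerClayBridge.Germ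

open Set Function Filter Topology InnerProductSpace Metric MeasureTheory
open scoped Topology ContDiff RealInnerProductSpace ENNReal NNReal
open Literature.Analysis.FluidPDE

namespace FreeRunStageAt

/-! ## §0 Elementary inequalities for the choice of the fade length (as in `PalasekTowerGermHostFreeRunAt`) -/

/-- `Kt · (η/(4Kt+1)) ≤ η/4` for `Kt ≥ 0`, `η > 0`. [folklore] -/
private theorem aux_Kh {η Kt : ℝ} (hη : 0 < η) (hKt : 0 ≤ Kt) : Kt * (η / (4 * Kt + 1)) ≤ η / 4 := by
  rw [mul_div_assoc', div_le_iff₀ (by positivity)]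
  nlinarith

/-- `c · (θ/(c+1)) ≤ θ` for `c ≥ 0`, `θ > 0`. [folklore] -/
private theorem aux_cθ {c θ : ℝ} (hc : 0 ≤ c) (hθ : 0 < θ) : c * (θ / (c + 1)) ≤ θ := by
  rw [mul_div_assoc', div_le_iff₀ (by positivity)]
  nlinarith

/-- `θ ≤ η/(a+1)` gives `θ · a ≤ η` for `a ≥ 0`, `η > 0`. [folklore] -/
private theorem aux_circ {θ η a : ℝ} (ha : 0 ≤ a) (hη : 0 < η) (hθ : θ ≤ η / (a + 1)) : θ * a ≤ η := by
  have h1 : θ * a ≤ η / (a + 1) * a := mul_le_mul_of_nonneg_right hθ ha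
  have h2 : η / (a + 1) * a ≤ η := by
    rw [div_mul_eq_mul_div, div_le_iff₀ (by positivity)]
    nlinarith
  exact h1.trans h2

/-- The gradient margin: `θ ≤ η h/4` and `Kt h ≤ η/4` give `2θ/h + (Kt + Kt) h ≤ η` (`h > 0`).
[folklore] -/
private theorem aux_grad {θ η h Kt : ℝ} (hh : 0 < h) (hθ : θ ≤ η * h / 4) (hKh : Kt * h ≤ η / 4) :
    2 * θ / h + (Kt + Kt) * h ≤ η := by
  have h1 : 2 * θ / h ≤ η / 2 := by
    rw [div_le_iff₀ hh]
    nlinarith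
  nlinarith

end FreeRunStageAt

open FreeRunStageAt

namespace LineGermDataAt

variable {R : TowerRates} {U : EuclideanSpace ℝ (Fin 3) → EuclideanSpace ℝ (Fin 3)} {ρ σ₀ ε c₄ : ℝ}
  (d : LineGermDataAt R U ρ σ₀ ε c₄)
include d

/-! ## §1 The slice-run door of the explicit slot, schedule exposed -/

/-- **THE SLICE-RUN DOOR OF THE EXPLICIT SLOT AT `R`, SCHEDULE EXPOSED**: as
`LineGermDataAt.episodeBaseGAt_of_sliceRun`, concluding with a registered level-`1` stage OF `d.schedule hR`.
[cite: Palasek2026ElementaryModel, §4] [cite: Sohr2001, Ch. V Thm. 1.5.1] -/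
theorem nonempty_stageOne_of_sliceRun {c₃' r' : ℝ} (hR : R.BoxNumerics c₃' r')
    {v : ℝ → EuclideanSpace ℝ (Fin 3) → EuclideanSpace ℝ (Fin 3)} {q : ℝ → EuclideanSpace ℝ (Fin 3) → ℝ}
    (hcl : IsClassicalNSSolutionOn (Icc 1 (Host.τfirstAt R)) 1 (lineForce U σ₀ ε) v q) (h1 : v 1 = U)
    (henergy : ∃ C : ℝ≥0∞, C < ⊤ ∧ ∀ t ∈ Icc (1 : ℝ) (Host.τfirstAt R), ∫⁻ x, ‖v t x‖ₑ ^ 2 ≤ C)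
    (hceil : ∀ t ∈ Icc (1 : ℝ) (Host.τfirstAt R), ∀ x, ‖v t x‖ ≤ 5 / 3 * R.Y 1)
    (hfloor : ∃ x, ‖x‖ ≤ ρ ∧ R.Y 1 ≤ ‖v (Host.τfirstAt R) x‖)
    (hstrain : ∃ x, ‖x‖ ≤ ρ ∧ R.A 1 ≤ ‖fderiv ℝ (v (Host.τfirstAt R)) x‖)
    (hcore : ∃ (x : EuclideanSpace ℝ (Fin 3)) (γ : ℝ → EuclideanSpace ℝ (Fin 3)),
      ‖x‖ ≤ ρ ∧ ContDiff ℝ 1 γ ∧ γ 0 = γ 1 ∧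
      (∀ s ∈ Icc (0 : ℝ) 1, γ s ∈ closedBall x (1 / R.N 1)) ∧
      (∀ s ∈ Icc (0 : ℝ) 1, ‖deriv γ s‖ ≤ 8 * Real.pi / R.N 1) ∧
      R.N 1 ^ (R.β - 2) ≤ circulation (v (Host.τfirstAt R)) γ) :
    Nonempty (Stage 1 R (d.schedule hR) (Margins.routeG R) 1) := by
  obtain ⟨s₀⟩ := d.stage hR
  obtain ⟨hrig, hqu, hpins, hτ0, hτ1, hf, hrad, hc₁, hc₂⟩ := d.schedule_facts hR
  set S := d.schedule hR with hS
  have hslice : s₀.u 1 = U := d.stage_slice hR s₀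
  have hext : ∃ s' : Stage 1 R S (Margins.routeG R) (0 + 1), s₀.Extends s' := by
    refine s₀.exists_extends_of_sliceRun one_pos (v := v) (q := q) ?_ ?_ ?_ ?_ ?_ ?_ ?_
    · show IsClassicalNSSolutionOn (Icc (S.τ 0) (S.τ (0 + 1))) 1 S.f v q
      rw [hτ0, zero_add, hτ1, hf]; exact hcl
    · show v (S.τ 0) = s₀.u (S.τ 0)
      rw [hτ0, h1, hslice]
    · show ∃ C : ℝ≥0∞, C < ⊤ ∧ ∀ t ∈ Icc (S.τ 0) (S.τ (0 + 1)), ∫⁻ x, ‖v t x‖ₑ ^ 2 ≤ C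
      rw [hτ0, zero_add, hτ1]; exact henergy
    · show ∀ t ∈ Icc (S.τ 0) (S.τ (0 + 1)), ∀ x, ‖v t x‖ ≤ S.c₂ * R.Y (0 + 1)
      rw [hτ0, zero_add, hτ1, hc₂]; exact hceil
    · show ∃ x, ‖x‖ ≤ S.radius ∧ S.c₁ * R.Y (0 + 1) ≤ ‖v (S.τ (0 + 1)) x‖
      rw [zero_add, hτ1, hrad, hc₁, one_mul]; exact hfloor
    · show ∃ x, ‖x‖ ≤ S.radius ∧ S.c₁ * R.A (0 + 1) ≤ ‖fderiv ℝ (v (S.τ (0 + 1))) x‖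
      rw [zero_add, hτ1, hrad, hc₁, one_mul]; exact hstrain
    · show ∃ (x : EuclideanSpace ℝ (Fin 3)) (γ : ℝ → EuclideanSpace ℝ (Fin 3)),
        ‖x‖ ≤ S.radius ∧ ContDiff ℝ 1 γ ∧ γ 0 = γ 1 ∧
        (∀ σ ∈ Icc (0 : ℝ) 1, γ σ ∈ closedBall x (1 / R.N (0 + 1))) ∧
        (∀ σ ∈ Icc (0 : ℝ) 1, ‖deriv γ σ‖ ≤ 8 * Real.pi / R.N (0 + 1)) ∧
        S.c₁ * R.N (0 + 1) ^ (R.β - 2) ≤ circulation (v (S.τ (0 + 1))) γ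
      rw [zero_add, hτ1, hrad, hc₁, one_mul]; exact hcore
  obtain ⟨s₁, -⟩ := hext
  exact ⟨s₁⟩

end LineGermDataAt

namespace LineGermDataAt

variable {R : TowerRates} {U : EuclideanSpace ℝ (Fin 3) → EuclideanSpace ℝ (Fin 3)} {ρ σ₀ ε₀ c₄ : ℝ}
  (d : LineGermDataAt R U ρ σ₀ ε₀ c₄)
include d

/-! ## §2 The free-run door of the explicit slot, schedule exposed -/

/-- **THE FREE-RUN DOOR AT THE RATES `R`, SCHEDULE EXPOSED.** `d : LineGermDataAt R U ρ σ₀ ε₀ c₄`,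
`hR : R.BoxNumerics c₃ r`, and ONE classical finite-energy FREE run on `[1, τ₁(R)]` from `v 1 = U` with margin `η > 0`
in the cap and the three level-`1` faces ⟹ for some fade `ε ∈ (0, ε₀]` and `dε : LineGermDataAt R U ρ σ₀ ε c₄`
(`d.restrictFade`), a registered level-`1` stage OF `dε.schedule hR` (proof verbatim from
`LineGermDataAt.episodeBaseGAt_of_freeRun`, last line changed). [cite: Palasek2026ElementaryModel, §4]
[cite: Tao2011, Thm. 5.4 (ii)+(iv)] [cite: Leray1934, §19 (3.4)–(3.8)] -/
theorem exists_fade_stageOne_of_freeRun {c₃ r : ℝ} (hR : R.BoxNumerics c₃ r)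
    {v : ℝ → EuclideanSpace ℝ (Fin 3) → EuclideanSpace ℝ (Fin 3)} {q : ℝ → EuclideanSpace ℝ (Fin 3) → ℝ}
    (hv : IsClassicalNSSolutionOn (Icc 1 (Host.τfirstAt R)) 1 0 v q) (hv1 : v 1 = U)
    (hvE : ∃ C : ℝ≥0∞, C < ⊤ ∧ ∀ t ∈ Icc (1 : ℝ) (Host.τfirstAt R), ∫⁻ x, ‖v t x‖ₑ ^ 2 ≤ C)
    {η : ℝ} (hη : 0 < η)
    (hcap : ∀ t ∈ Icc (1 : ℝ) (Host.τfirstAt R), ∀ x, ‖v t x‖ ≤ 5 / 3 * R.Y 1 - η)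
    (hspeed : ∃ x, ‖x‖ ≤ ρ ∧ R.Y 1 + η ≤ ‖v (Host.τfirstAt R) x‖)
    (hstrain : ∃ x, ‖x‖ ≤ ρ ∧ R.A 1 + η ≤ ‖fderiv ℝ (v (Host.τfirstAt R)) x‖)
    (hcore : ∃ (x : EuclideanSpace ℝ (Fin 3)) (γ : ℝ → EuclideanSpace ℝ (Fin 3)),
      ‖x‖ ≤ ρ ∧ ContDiff ℝ 1 γ ∧ γ 0 = γ 1 ∧
      (∀ s ∈ Icc (0 : ℝ) 1, γ s ∈ closedBall x (1 / R.N 1)) ∧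
      (∀ s ∈ Icc (0 : ℝ) 1, ‖deriv γ s‖ ≤ 8 * Real.pi / R.N 1) ∧
      R.N 1 ^ (R.β - 2) + η ≤ circulation (v (Host.τfirstAt R)) γ) :
    ∃ (ε : ℝ) (dε : LineGermDataAt R U ρ σ₀ ε c₄), Nonempty (Stage 1 R (dε.schedule hR) (Margins.routeG R) 1) := by
  -- ### the window `[0, W]` in shifted time, the cap `M`
  set W : ℝ := (Host.wfirstAt R) with hW_def
  have hW : 0 < W := (Host.wfirstAt_pos R)
  have hτ : (Host.τfirstAt R) = 1 + W := (Host.τfirstAt_eq R)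
  set M : ℝ := 5 / 3 * R.Y 1 with hM_def
  have hY1 : 0 < R.Y 1 := Real.rpow_pos_of_pos (R.N_pos 1) _
  have hM : 0 < M := by positivity
  have hN1 : 0 < R.N 1 := R.N_pos 1
  -- ### the shifted free run `v' t = v (t + 1)` on `[0, W]`
  have hmemW : ∀ {t : ℝ}, t ∈ Icc 0 W → t + 1 ∈ Icc (1 : ℝ) (Host.τfirstAt R) := fun ht =>
    ⟨by linarith [ht.1], by rw [hτ]; linarith [ht.2]⟩
  have hv' : IsClassicalNSSolutionOn (Icc 0 W) 1 0 (fun t => v (t + 1)) (fun t => q (t + 1)) :=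
    (hv.comp_add_right 1).mono (fun t ht => hmemW ht) (uniqueDiffOn_Icc hW)
  have hv'E : ∃ C : ℝ≥0∞, C < ⊤ ∧ ∀ t ∈ Icc 0 W, ∫⁻ x, ‖v (t + 1) x‖ₑ ^ 2 ≤ C := by
    obtain ⟨C, hC, hb⟩ := hvE
    exact ⟨C, hC, fun t ht => hb (t + 1) (hmemW ht)⟩
  have hv'bd : ∀ t ∈ Icc 0 W, ∀ x, ‖v (t + 1) x‖ ≤ M := fun t ht x =>
    (hcap (t + 1) (hmemW ht) x).trans (by linarith)
  have hU0 : HasRapidSpatialDecay U := HasRapidSpatialDecay.of_hasCompactSupport d.smooth d.compact_confined.1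
  have hv'0' : HasRapidSpatialDecay ((fun t => v (t + 1)) 0) := by
    simp only [zero_add, hv1]; exact hU0
  -- ### the second derivatives of the free run at the final time
  have ha_Hinf : ∀ m : ℕ, ∫⁻ x, ‖iteratedFDeriv ℝ m ((fun t => v (t + 1)) 0) x‖ₑ ^ 2 < ⊤ := fun m => by
    simp only [zero_add, hv1]; exact hU0.lintegral_enorm_iteratedFDeriv_sq_lt_top m
  have hv'Enn : ∃ C : ℝ≥0, ∀ t ∈ Icc 0 W, ∫⁻ x, ‖v (t + 1) x‖ₑ ^ 2 ≤ C := by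
    obtain ⟨C, hC, hb⟩ := hv'E
    exact ⟨C.toNNReal, fun t ht => (hb t ht).trans (ENNReal.coe_toNNReal hC.ne).ge⟩
  obtain ⟨Ku, -, hKu⟩ := hv'.exists_norm_iteratedFDeriv_le_of_sobolevDatum one_pos hW hv'Enn ha_Hinf
    (fun m => ⟨0, fun t _ => by simp⟩) 2
  have hKuW : ∀ x, ‖iteratedFDeriv ℝ 2 (v (W + 1)) x‖ ≤ Ku := fun x => hKu W ⟨hW.le, le_rfl⟩ x
  -- ### the uniform second-derivative bound of perturbed runs, the force's size
  obtain ⟨K, hK⟩ := PerturbedRun.exists_uniform_final_iteratedFDeriv_two_bound M W hM hW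
  obtain ⟨L, hL0, hL⟩ := d.exists_norm_lineForce_le_mul
  set Vρ : ℝ := Real.sqrt (volume (closedBall (0 : EuclideanSpace ℝ (Fin 3)) ρ)).toReal with hVρ
  have hVρ0 : 0 ≤ Vρ := Real.sqrt_nonneg _
  set C₀ : ℝ := oseenSliceConst (EuclideanSpace ℝ (Fin 3)) with hC₀
  set lam : ℝ := 36 * C₀ ^ 2 * (M + (M + 1)) ^ 2 / 1 with hlam_def
  have hlam0 : 0 ≤ lam := by positivity
  -- the closeness bound as a function of `ε`: `Φ ε = cΦ * ε`
  set cΦ : ℝ := 2 * (4 * (1 : ℝ) ^ (-(3 / 4 : ℝ)) * W ^ (1 / 4 : ℝ) * (L * Vρ)) * Real.exp (lam * W)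
    with hcΦ_def
  have hcΦ0 : 0 ≤ cΦ := by positivity
  -- ### the margins
  set Kt : ℝ := max K 0 + max Ku 0 with hKt
  have hKt0 : 0 ≤ Kt := by positivity
  set h : ℝ := η / (4 * Kt + 1) with hh_def
  have hh : 0 < h := by positivity
  have hKh : Kt * h ≤ η / 4 := aux_Kh hη hKt0
  set θ : ℝ := min (1 / 2) (min (η / 2) (min (η / (8 * Real.pi / R.N 1 + 1)) (η * h / 4)))
    with hθ_def
  have hθpos : 0 < θ := by
    refine lt_min (by norm_num) (lt_min (by positivity) (lt_min ?_ (by positivity)))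
    exact div_pos hη (by positivity)
  have hθ12 : θ ≤ 1 / 2 := min_le_left _ _
  have hθη : θ ≤ η / 2 := (min_le_right _ _).trans (min_le_left _ _)
  have hθcirc : θ ≤ η / (8 * Real.pi / R.N 1 + 1) :=
    (min_le_right _ _).trans ((min_le_right _ _).trans (min_le_left _ _))
  have hθgrad : θ ≤ η * h / 4 := (min_le_right _ _).trans ((min_le_right _ _).trans (min_le_right _ _))
  -- ### the fade length
  set ε : ℝ := min ε₀ (min (W / 2) (θ / (cΦ + 1))) with hε_def
  have hεpos : 0 < ε := lt_min d.fade_pos (lt_min (by positivity) (by positivity))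
  have hεε₀ : ε ≤ ε₀ := min_le_left _ _
  have hεW : ε ≤ W / 2 := (min_le_right _ _).trans (min_le_left _ _)
  have hεθ : cΦ * ε ≤ θ := by
    have h1 : ε ≤ θ / (cΦ + 1) := (min_le_right _ _).trans (min_le_right _ _)
    calc cΦ * ε ≤ cΦ * (θ / (cΦ + 1)) := mul_le_mul_of_nonneg_left h1 hcΦ0
      _ ≤ θ := aux_cθ hcΦ0 hθpos
  have dε : LineGermDataAt R U ρ σ₀ ε c₄ := d.restrictFade hεpos hεε₀
  -- ### the shifted force `f' t = lineForce U σ₀ ε (t + 1)`: Clay class, zero from `ε` on, `O(ε)` in `L²`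
  set f' : ℝ → EuclideanSpace ℝ (Fin 3) → EuclideanSpace ℝ (Fin 3) := fun t => lineForce U σ₀ ε (t + 1)
    with hf'_def
  have hfs : IsSmoothOnHalfSpace f' := (dε.schedule hR).force_smooth.timeShift zero_le_one
  have hfd : HasRapidSpaceTimeDecay f' := (dε.schedule hR).force_decay.timeShift (dε.schedule hR).force_smooth
    zero_le_one
  have hfzero : ∀ t, W / 2 ≤ t → ∀ x, f' t x = 0 := fun t ht x =>
    LineGermData.lineForce_eq_zero_of_ge hεpos (by linarith) x
  set G₂r : ℝ := L * ε * Vρ with hG₂r_def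
  have hG₂r0 : 0 ≤ G₂r := by positivity
  have hfL2 : ∀ t ∈ Icc 0 W, eLpNorm (f' t) 2 volume ≤ ENNReal.ofReal G₂r := by
    intro t ht
    have hbd : ∀ y, ‖f' t y‖ ≤ L * ε := by
      intro y
      by_cases htε : t + 1 ≤ 1 + ε
      · rw [mul_comm]; exact hL ε hεpos hεε₀ (t + 1) ⟨by linarith [ht.1], htε⟩ y
      · rw [not_le] at htε
        show ‖lineForce U σ₀ ε (t + 1) y‖ ≤ L * ε
        rw [LineGermData.lineForce_eq_zero_of_ge hεpos htε.le y, norm_zero]; positivity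
    have hconf : ∀ y, ρ < ‖y‖ → f' t y = 0 := fun y hy => dε.force_facts.2.2.1 (t + 1) y hy
    have := LineGermData.eLpNorm_two_le_of_confined' (ρ := ρ) hbd hconf
    simpa [hG₂r_def, hVρ, mul_assoc] using this
  -- ### the smallness of the force
  have hΦval : 2 * (0 + 4 * (1 : ℝ) ^ (-(3 / 4 : ℝ)) * W ^ (1 / 4 : ℝ) * G₂r) * Real.exp (lam * W) = cΦ * ε := by
    rw [hcΦ_def, hG₂r_def]; ring
  have hΦ : 2 * (0 + 4 * (1 : ℝ) ^ (-(3 / 4 : ℝ)) * W ^ (1 / 4 : ℝ) * G₂r) *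
      Real.exp (36 * oseenSliceConst (EuclideanSpace ℝ (Fin 3)) ^ 2 * (M + (M + 1)) ^ 2 / 1 * W) ≤ 1 / 2 := by
    rw [← hC₀, ← hlam_def, hΦval]
    exact hεθ.trans hθ12
  -- ### THE PERTURBED RUN on `[0, W]`
  obtain ⟨u', p', hcl', hu'0, hE', hclose⟩ :=
    PerturbedRun.exists_forced_run_near_free_run one_pos hW hfs hfd hv' hv'E hM hv'bd hv'0' hG₂r0 hfL2 hΦ
  -- the closeness `≤ θ` on the whole window
  have hclose' : ∀ t ∈ Icc 0 W, ∀ x, ‖u' t x - v (t + 1) x‖ ≤ θ := by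
    intro t ht x
    refine (hclose t ht x).trans ?_
    have h1 : Real.exp (36 * oseenSliceConst (EuclideanSpace ℝ (Fin 3)) ^ 2 * (M + (M + 1)) ^ 2 / 1 * t) ≤
        Real.exp (lam * W) := by
      rw [← hC₀, ← hlam_def]
      exact Real.exp_le_exp.2 (mul_le_mul_of_nonneg_left ht.2 hlam0)
    calc 2 * (0 + 4 * (1 : ℝ) ^ (-(3 / 4 : ℝ)) * W ^ (1 / 4 : ℝ) * G₂r) *
          Real.exp (36 * oseenSliceConst (EuclideanSpace ℝ (Fin 3)) ^ 2 * (M + (M + 1)) ^ 2 / 1 * t)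
        ≤ 2 * (0 + 4 * (1 : ℝ) ^ (-(3 / 4 : ℝ)) * W ^ (1 / 4 : ℝ) * G₂r) * Real.exp (lam * W) :=
          mul_le_mul_of_nonneg_left h1 (by positivity)
      _ = cΦ * ε := hΦval
      _ ≤ θ := hεθ
  have hu'bd : ∀ t ∈ Icc 0 W, ∀ x, ‖u' t x‖ ≤ M + 1 / 2 := by
    intro t ht x
    calc ‖u' t x‖ = ‖v (t + 1) x + (u' t x - v (t + 1) x)‖ := by rw [add_sub_cancel]
      _ ≤ ‖v (t + 1) x‖ + ‖u' t x - v (t + 1) x‖ := norm_add_le _ _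
      _ ≤ M + 1 / 2 := add_le_add (hv'bd t ht x) ((hclose' t ht x).trans hθ12)
  -- ### the gradient at the final time
  have hu'0' : HasRapidSpatialDecay (u' 0) := by rw [hu'0]; exact hv'0'
  have hK' : ∀ x, ‖iteratedFDeriv ℝ 2 (u' W) x‖ ≤ Kt := fun x => by
    have h1 := hK hfs hfd hfzero hcl' hE' hu'0' hu'bd x
    have h2 := le_max_left K 0
    have h3 := le_max_right Ku 0
    show ‖iteratedFDeriv ℝ 2 (u' W) x‖ ≤ max K 0 + max Ku 0
    linarith
  have hKuW' : ∀ x, ‖iteratedFDeriv ℝ 2 ((fun t => v (t + 1)) W) x‖ ≤ Kt := fun x => by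
    have h1 := hKuW x
    have h2 := le_max_left Ku 0
    have h3 := le_max_right K 0
    show ‖iteratedFDeriv ℝ 2 (v (W + 1)) x‖ ≤ max K 0 + max Ku 0
    linarith
  have hWmem : W ∈ Icc 0 W := ⟨hW.le, le_rfl⟩
  have h2u' : ContDiff ℝ 2 (u' W) := (hcl'.contDiff_velocity hWmem).of_le (by norm_cast)
  have h2v : ContDiff ℝ 2 ((fun t : ℝ => v (t + 1)) W) :=
    (hv'.contDiff_velocity hWmem).of_le (by norm_cast)
  have hcl0 : ∀ x, ‖u' W x - (fun t : ℝ => v (t + 1)) W x‖ ≤ θ := fun x => hclose' W hWmem x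
  have hgrad : ∀ x, ‖fderiv ℝ (u' W) x - fderiv ℝ (v (W + 1)) x‖ ≤ η := by
    intro x
    have hL' := PerturbedRun.norm_fderiv_sub_le_final (T := W) (Φ := θ) (K := Kt) (Ku := Kt) (h := h)
      (u := fun t : ℝ => v (t + 1)) (u' := u') h2v h2u' hcl0 hK' hKuW' hh x
    exact hL'.trans (aux_grad hh hθgrad hKh)
  -- ### shift back to `[1, τfirst]`: `w t = u' (t − 1)`
  set w : ℝ → EuclideanSpace ℝ (Fin 3) → EuclideanSpace ℝ (Fin 3) := fun t => u' (t + -1) with hw_def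
  set r : ℝ → EuclideanSpace ℝ (Fin 3) → ℝ := fun t => p' (t + -1) with hr_def
  have hmemI : ∀ {t : ℝ}, t ∈ Icc (1 : ℝ) (Host.τfirstAt R) → t + -1 ∈ Icc 0 W := fun ht =>
    ⟨by linarith [ht.1], by rw [hτ] at ht; linarith [ht.2]⟩
  have hwsol : IsClassicalNSSolutionOn (Icc 1 (Host.τfirstAt R)) 1 (lineForce U σ₀ ε) w r := by
    have h1 : IsClassicalNSSolutionOn (Icc 1 (Host.τfirstAt R)) 1 (fun t => f' (t + -1)) w r :=
      (hcl'.comp_add_right (-1)).mono (fun t ht => hmemI ht) (uniqueDiffOn_Icc (by rw [hτ]; linarith))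
    exact h1.congr_force fun t _ x => by
      show lineForce U σ₀ ε (t + -1 + 1) x = lineForce U σ₀ ε t x
      rw [neg_add_cancel_right]
  have hwτ : w (Host.τfirstAt R) = u' W := by
    show u' ((Host.τfirstAt R) + -1) = u' W
    rw [hτ]; ring_nf
  have hvτ : v (Host.τfirstAt R) = v (W + 1) := by rw [hτ, add_comm]
  refine ⟨ε, dε, dε.nonempty_stageOne_of_sliceRun hR hwsol ?_ ?_ ?_ ?_ ?_ ?_⟩
  · -- `w 1 = U`
    show u' (1 + -1) = U
    rw [add_neg_cancel, hu'0]
    simp only [zero_add, hv1]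
  · -- energy
    obtain ⟨C, hC, hb⟩ := hE'
    exact ⟨C, hC, fun t ht => hb (t + -1) (hmemI ht)⟩
  · -- the cap
    intro t ht x
    have h1 := hclose' (t + -1) (hmemI ht) x
    have h2 := hcap t ht x
    have h3 : v (t + -1 + 1) = v t := by rw [neg_add_cancel_right]
    rw [h3] at h1
    calc ‖w t x‖ = ‖v t x + (u' (t + -1) x - v t x)‖ := by rw [add_sub_cancel]
      _ ≤ ‖v t x‖ + ‖u' (t + -1) x - v t x‖ := norm_add_le _ _
      _ ≤ 5 / 3 * R.Y 1 := by linarith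
  · -- the speed floor
    obtain ⟨x, hx, hfl⟩ := hspeed
    refine ⟨x, hx, ?_⟩
    have h1 := hclose' W hWmem x
    rw [hwτ]
    rw [hvτ] at hfl
    have h2 : ‖v (W + 1) x‖ ≤ ‖u' W x‖ + ‖u' W x - v (W + 1) x‖ := by
      calc ‖v (W + 1) x‖ = ‖u' W x - (u' W x - v (W + 1) x)‖ := by rw [sub_sub_cancel]
        _ ≤ ‖u' W x‖ + ‖u' W x - v (W + 1) x‖ := norm_sub_le _ _
    linarith
  · -- the strain floor
    obtain ⟨x, hx, hst⟩ := hstrain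
    refine ⟨x, hx, ?_⟩
    have h1 := hgrad x
    rw [hwτ]
    rw [hvτ] at hst
    have h2 : ‖fderiv ℝ (v (W + 1)) x‖ ≤ ‖fderiv ℝ (u' W) x‖ + ‖fderiv ℝ (u' W) x - fderiv ℝ (v (W + 1)) x‖ := by
      calc ‖fderiv ℝ (v (W + 1)) x‖
          = ‖fderiv ℝ (u' W) x - (fderiv ℝ (u' W) x - fderiv ℝ (v (W + 1)) x)‖ := by rw [sub_sub_cancel]
        _ ≤ ‖fderiv ℝ (u' W) x‖ + ‖fderiv ℝ (u' W) x - fderiv ℝ (v (W + 1)) x‖ := norm_sub_le _ _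
    linarith
  · -- the core loop
    obtain ⟨x, γ, hx, hγ, hγ01, hγball, hγspeed, hcirc⟩ := hcore
    refine ⟨x, γ, hx, hγ, hγ01, hγball, hγspeed, ?_⟩
    rw [hwτ]
    rw [hvτ] at hcirc
    have hcu : Continuous (u' W) := (hcl'.contDiff_velocity hWmem).continuous
    have hcv : Continuous (v (W + 1)) := (hv'.contDiff_velocity hWmem).continuous
    have hnear : ∀ s ∈ Icc (0 : ℝ) 1, ‖u' W (γ s) - v (W + 1) (γ s)‖ ≤ θ := fun s _ =>
      hclose' W hWmem (γ s)
    have h1 := circulation_sub_le_of_near hcv hcu hγ hγspeed hnear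
    -- `θ · (8π/N₁) ≤ η`
    have h2 : θ * (8 * Real.pi / R.N 1) ≤ η := aux_circ (by positivity) hη hθcirc
    linarith

end LineGermDataAt

/-! ## §3 The abstract slot -/

/-- **THE FREE-RUN DOOR AT `R`, ABSTRACT-SLOT FORM, SCHEDULE EXPOSED**: `h : LevelZeroDataAt R U ρ` and ONE free run
with margins ⟹ for some explicit slot `d : LineGermDataAt R U ρ σ₀ ε 1` of the same profile, a registered level-`1`
stage of `d.schedule hR`. [cite: Palasek2026ElementaryModel, §4] -/
theorem LevelZeroDataAt.exists_lineGerm_stageOne_of_freeRun {R : TowerRates}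
    {U : EuclideanSpace ℝ (Fin 3) → EuclideanSpace ℝ (Fin 3)} {ρ : ℝ} (h : LevelZeroDataAt R U ρ)
    {c₃ r : ℝ} (hR : R.BoxNumerics c₃ r)
    {v : ℝ → EuclideanSpace ℝ (Fin 3) → EuclideanSpace ℝ (Fin 3)} {q : ℝ → EuclideanSpace ℝ (Fin 3) → ℝ}
    (hv : IsClassicalNSSolutionOn (Icc 1 (Host.τfirstAt R)) 1 0 v q) (hv1 : v 1 = U)
    (hvE : ∃ C : ℝ≥0∞, C < ⊤ ∧ ∀ t ∈ Icc (1 : ℝ) (Host.τfirstAt R), ∫⁻ x, ‖v t x‖ₑ ^ 2 ≤ C)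
    {η : ℝ} (hη : 0 < η)
    (hcap : ∀ t ∈ Icc (1 : ℝ) (Host.τfirstAt R), ∀ x, ‖v t x‖ ≤ 5 / 3 * R.Y 1 - η)
    (hspeed : ∃ x, ‖x‖ ≤ ρ ∧ R.Y 1 + η ≤ ‖v (Host.τfirstAt R) x‖)
    (hstrain : ∃ x, ‖x‖ ≤ ρ ∧ R.A 1 + η ≤ ‖fderiv ℝ (v (Host.τfirstAt R)) x‖)
    (hcore : ∃ (x : EuclideanSpace ℝ (Fin 3)) (γ : ℝ → EuclideanSpace ℝ (Fin 3)),
      ‖x‖ ≤ ρ ∧ ContDiff ℝ 1 γ ∧ γ 0 = γ 1 ∧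
      (∀ s ∈ Icc (0 : ℝ) 1, γ s ∈ closedBall x (1 / R.N 1)) ∧
      (∀ s ∈ Icc (0 : ℝ) 1, ‖deriv γ s‖ ≤ 8 * Real.pi / R.N 1) ∧
      R.N 1 ^ (R.β - 2) + η ≤ circulation (v (Host.τfirstAt R)) γ) :
    ∃ (σ₀ ε : ℝ) (d : LineGermDataAt R U ρ σ₀ ε 1), Nonempty (Stage 1 R (d.schedule hR) (Margins.routeG R) 1) := by
  obtain ⟨ε, dε, hst⟩ := (h.lineGermDataAt one_pos le_rfl).exists_fade_stageOne_of_freeRun hR hv hv1 hvE hη hcap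
    hspeed hstrain hcore
  exact ⟨_, ε, dε, hst⟩

end Summit.NavierStokesRegularity.FluidComputer.PalasekTowerClayBridge.Germ

end
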